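import Mathlib
import Summits.Ventures.HodgeRepro0.P5S4TransportBasic

/-!
# P5S4TransportTypes — transport of the remaining clauses of Theorem A (1)–(2): transitivity on a block,
block-system primitivity of a block type, and the Kubota rank (P5-Dim8Census-S4Equivariance-v1 §2), kernel-checked

Third file of the kernel-checked core of Theorem A of proofs/P5-Dim8Census-S4Equivariance-v1.md (cell
pub-hodge-repro0, seat p5; the first two are `P5S4TransportBasic` and `P5S4Transport`). For a finite set `T` of
permutations of `S`, finite sets `X, Φ ⊆ S` and a permutation `w` of `S`, with `T' = w T w⁻¹`, `X' = wX`, `Φ' = wΦ`: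

* `transitiveOn_transport`: `T'` is transitive on `X'` iff `T` is transitive on `X`;
* `isBlockSystem_transport`: `ℬ` is a block system of `T` on `X` (a partition of `X` into nonempty blocks permuted
  by every `t ∈ T`) iff `wℬ` is a block system of `T'` on `X'`; `nontrivial` and «`Φ ∩ X` is a union of blocks»
  are transported likewise, hence
* `primitiveType_transport`: `Φ ∩ X` is a primitive block type for `T` on `X` (Def 1.1 of P5-LowDimCensus: not a
  union of blocks of a nontrivial block system) iff `Φ' ∩ X'` is one for `T'` on `X'`;
* `finrank_kubotaSpan_transport`: the Kubota rank — the dimension of the ℚ-span of the indicator vectors of the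
  translates `tΦ`, `t ∈ T` — is unchanged (`kubotaSpan (wTw⁻¹) (wΦ)` is the image of `kubotaSpan T Φ` under the
  linear automorphism `f ↦ f ∘ w⁻¹` of `S → ℚ`).

With `P5S4TransportBasic` / `P5S4Transport` this certifies Theorem A (1)–(4) of the page except the clauses about
the pair structure (`T̄`, `N = T ∩ D`, linked pairs — Theorem A (1), paper proof in the page §2) and the
count-level sums of Theorem B (iv). Nothing about the census figures is certified.
-/

namespace HodgeRepro0.P5S4Transport

open Finset

variable {S : Type*}

/-- `T` is transitive on `X`: any two points of `X` are related by some `t ∈ T` -/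
def TransitiveOn (T : Finset (Equiv.Perm S)) (X : Finset S) : Prop := ∀ x ∈ X, ∀ y ∈ X, ∃ t ∈ T, t x = y

/-- transitivity is transported: `wTw⁻¹` is transitive on `wX` iff `T` is transitive on `X` -/
theorem transitiveOn_transport (w : Equiv.Perm S) (T : Finset (Equiv.Perm S)) (X : Finset S) :
    TransitiveOn (conjF w T) (smulF w X) ↔ TransitiveOn T X := by
  unfold TransitiveOn
  constructor
  · intro h x hx y hy
    obtain ⟨t', ht', he⟩ := h (w x) (by rw [mem_smulF]; simpa using hx) (w y) (by rw [mem_smulF]; simpa using hy)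
    refine ⟨w⁻¹ * t' * w, mem_conjF.1 ht', ?_⟩
    simp only [Equiv.Perm.mul_apply]
    rw [he]; simp
  · intro h x' hx' y' hy'
    rw [mem_smulF] at hx' hy'
    obtain ⟨t, ht, he⟩ := h _ hx' _ hy'
    refine ⟨w * t * w⁻¹, conjF_mem ht, ?_⟩
    simp only [Equiv.Perm.mul_apply]
    rw [he]; simp

/-- `wA` and `wB` are disjoint iff `A` and `B` are -/
theorem disjoint_smulF (w : Equiv.Perm S) (A B : Finset S) : Disjoint (smulF w A) (smulF w B) ↔ Disjoint A B := by
  unfold smulF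
  exact Finset.disjoint_map _

/-- `wA ⊆ wB ↔ A ⊆ B` -/
theorem smulF_subset_smulF (w : Equiv.Perm S) {A B : Finset S} : smulF w A ⊆ smulF w B ↔ A ⊆ B :=
  Finset.map_subset_map

/-- the linear automorphism `f ↦ f ∘ w⁻¹` of `S → ℚ` -/
def relabel (w : Equiv.Perm S) : (S → ℚ) ≃ₗ[ℚ] (S → ℚ) := LinearEquiv.funCongrLeft ℚ ℚ w⁻¹

/-- `relabel w f = fun x => f (w⁻¹ x)` -/
theorem relabel_apply (w : Equiv.Perm S) (f : S → ℚ) : relabel w f = fun x => f (w⁻¹ x) := rfl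

section decEq

variable [DecidableEq S]

/-- `ℬ` is a block system of `T` on `X`: its blocks are nonempty, pairwise disjoint, cover exactly `X`, and every
`t ∈ T` maps blocks to blocks -/
structure IsBlockSystem (T : Finset (Equiv.Perm S)) (X : Finset S) (ℬ : Finset (Finset S)) : Prop where
  nonempty : ∀ B ∈ ℬ, B.Nonempty
  disjoint : ∀ B ∈ ℬ, ∀ C ∈ ℬ, B ≠ C → Disjoint B C
  cover : ∀ x, x ∈ X ↔ ∃ B ∈ ℬ, x ∈ B
  stable : ∀ t ∈ T, ∀ B ∈ ℬ, smulF t B ∈ ℬ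

/-- a block system is nontrivial if it has a block with more than one point and more than one block -/
def NontrivialSystem (ℬ : Finset (Finset S)) : Prop := (∃ B ∈ ℬ, 1 < B.card) ∧ 1 < ℬ.card

/-- `Y` is a union of blocks of `ℬ`: every block is inside `Y` or disjoint from it -/
def IsUnionOfBlocks (Y : Finset S) (ℬ : Finset (Finset S)) : Prop := ∀ B ∈ ℬ, B ⊆ Y ∨ Disjoint B Y

/-- the block type `Φ ∩ X` is PRIMITIVE for `T` on `X` (Def 1.1): it is not a union of blocks of a nontrivial block
system of `T` on `X` -/
def PrimitiveType (T : Finset (Equiv.Perm S)) (X Φ : Finset S) : Prop :=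
  ∀ ℬ, IsBlockSystem T X ℬ → NontrivialSystem ℬ → ¬ IsUnionOfBlocks (Φ ∩ X) ℬ

/-- the image of a system of sets under `w` -/
def smulSys (w : Equiv.Perm S) (ℬ : Finset (Finset S)) : Finset (Finset S) := ℬ.image (smulF w)

/-- membership in the image system -/
theorem mem_smulSys {w : Equiv.Perm S} {ℬ : Finset (Finset S)} {C : Finset S} :
    C ∈ smulSys w ℬ ↔ smulF w⁻¹ C ∈ ℬ := by
  unfold smulSys
  rw [Finset.mem_image]
  constructor
  · rintro ⟨B, hB, rfl⟩
    rwa [inv_smulF_smulF]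
  · intro h
    exact ⟨smulF w⁻¹ C, h, smulF_inv_smulF w C⟩

/-- `w⁻¹` undoes `w` on systems -/
theorem smulSys_inv_smulSys (w : Equiv.Perm S) (ℬ : Finset (Finset S)) : smulSys w (smulSys w⁻¹ ℬ) = ℬ := by
  ext C
  rw [mem_smulSys, mem_smulSys, inv_inv, smulF_inv_smulF]

/-- `|wℬ| = |ℬ|` -/
theorem card_smulSys (w : Equiv.Perm S) (ℬ : Finset (Finset S)) : (smulSys w ℬ).card = ℬ.card :=
  Finset.card_image_of_injective _ (smulF_injective w)

/-- block systems are transported: `ℬ` is a block system of `T` on `X` iff `wℬ` is one of `wTw⁻¹` on `wX` -/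
theorem isBlockSystem_transport (w : Equiv.Perm S) (T : Finset (Equiv.Perm S)) (X : Finset S)
    (ℬ : Finset (Finset S)) : IsBlockSystem (conjF w T) (smulF w X) (smulSys w ℬ) ↔ IsBlockSystem T X ℬ := by
  constructor
  · intro h
    refine ⟨?_, ?_, ?_, ?_⟩
    · intro B hB
      have := h.nonempty (smulF w B) (by rw [mem_smulSys, inv_smulF_smulF]; exact hB)
      exact (smulF_nonempty w).1 this
    · intro B hB C hC hne
      have := h.disjoint (smulF w B) (by rw [mem_smulSys, inv_smulF_smulF]; exact hB)
        (smulF w C) (by rw [mem_smulSys, inv_smulF_smulF]; exact hC)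
        (fun e => hne (smulF_injective w e))
      exact (disjoint_smulF w B C).1 this
    · intro x
      have := h.cover (w x)
      rw [mem_smulF, show w⁻¹ (w x) = x by simp] at this
      rw [this]
      constructor
      · rintro ⟨B', hB', hx⟩
        refine ⟨smulF w⁻¹ B', (mem_smulSys).1 hB', ?_⟩
        rw [mem_smulF, inv_inv]; exact hx
      · rintro ⟨B, hB, hx⟩
        refine ⟨smulF w B, by rw [mem_smulSys, inv_smulF_smulF]; exact hB, ?_⟩
        rw [mem_smulF]; simpa using hx
    · intro t ht B hB
      have := h.stable (w * t * w⁻¹) (conjF_mem ht) (smulF w B) (by rw [mem_smulSys, inv_smulF_smulF]; exact hB)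
      rw [mem_smulSys, ← smulF_mul, ← smulF_mul, show w⁻¹ * (w * t * w⁻¹) * w = t by group] at this
      exact this
  · intro h
    refine ⟨?_, ?_, ?_, ?_⟩
    · intro B' hB'
      rw [mem_smulSys] at hB'
      have := h.nonempty _ hB'
      rw [← smulF_inv_smulF w B']
      exact (smulF_nonempty w).2 this
    · intro B' hB' C' hC' hne
      rw [mem_smulSys] at hB' hC'
      have := h.disjoint _ hB' _ hC' (fun e => hne (by rw [← smulF_inv_smulF w B', ← smulF_inv_smulF w C', e]))
      rw [← smulF_inv_smulF w B', ← smulF_inv_smulF w C']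
      exact (disjoint_smulF w _ _).2 this
    · intro x'
      rw [mem_smulF, h.cover]
      constructor
      · rintro ⟨B, hB, hx⟩
        refine ⟨smulF w B, by rw [mem_smulSys, inv_smulF_smulF]; exact hB, ?_⟩
        rw [mem_smulF]; exact hx
      · rintro ⟨B', hB', hx⟩
        rw [mem_smulSys] at hB'
        refine ⟨smulF w⁻¹ B', hB', ?_⟩
        rw [mem_smulF, inv_inv]; simpa using hx
    · intro t' ht' B' hB'
      rw [mem_smulSys] at hB' ⊢
      have := h.stable (w⁻¹ * t' * w) (mem_conjF.1 ht') _ hB'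
      rw [← smulF_mul, show w⁻¹ * t' * w * w⁻¹ = w⁻¹ * t' by group] at this
      rw [← smulF_mul]
      exact this

/-- nontriviality is transported -/
theorem nontrivialSystem_transport (w : Equiv.Perm S) (ℬ : Finset (Finset S)) :
    NontrivialSystem (smulSys w ℬ) ↔ NontrivialSystem ℬ := by
  unfold NontrivialSystem
  rw [card_smulSys]
  refine and_congr ?_ Iff.rfl
  constructor
  · rintro ⟨B', hB', hc⟩
    rw [mem_smulSys] at hB'
    refine ⟨_, hB', ?_⟩
    rwa [card_smulF]
  · rintro ⟨B, hB, hc⟩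
    refine ⟨smulF w B, by rw [mem_smulSys, inv_smulF_smulF]; exact hB, ?_⟩
    rwa [card_smulF]

/-- «union of blocks» is transported -/
theorem isUnionOfBlocks_transport (w : Equiv.Perm S) (Y : Finset S) (ℬ : Finset (Finset S)) :
    IsUnionOfBlocks (smulF w Y) (smulSys w ℬ) ↔ IsUnionOfBlocks Y ℬ := by
  unfold IsUnionOfBlocks
  constructor
  · intro h B hB
    have := h (smulF w B) (by rw [mem_smulSys, inv_smulF_smulF]; exact hB)
    rw [smulF_subset_smulF, disjoint_smulF] at this
    exact this
  · intro h B' hB'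
    rw [mem_smulSys] at hB'
    have := h _ hB'
    rw [← smulF_inv_smulF w B', smulF_subset_smulF, disjoint_smulF]
    exact this

/-- PRIMITIVITY OF A BLOCK TYPE IS TRANSPORTED: `Φ ∩ X` is primitive for `T` on `X` iff `wΦ ∩ wX` is primitive
for `wTw⁻¹` on `wX` (Theorem A (2) of the page) -/
theorem primitiveType_transport (w : Equiv.Perm S) (T : Finset (Equiv.Perm S)) (X Φ : Finset S) :
    PrimitiveType (conjF w T) (smulF w X) (smulF w Φ) ↔ PrimitiveType T X Φ := by
  unfold PrimitiveType
  constructor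
  · intro h ℬ hB hn hu
    refine h (smulSys w ℬ) ((isBlockSystem_transport w T X ℬ).2 hB) ((nontrivialSystem_transport w ℬ).2 hn) ?_
    rw [← smulF_inter]
    exact (isUnionOfBlocks_transport w _ ℬ).2 hu
  · intro h ℬ' hB hn hu
    rw [← smulSys_inv_smulSys w ℬ'] at hB hn hu
    refine h _ ((isBlockSystem_transport w T X _).1 hB) ((nontrivialSystem_transport w _).1 hn) ?_
    rw [← smulF_inter] at hu
    exact (isUnionOfBlocks_transport w _ _).1 hu

/-- the indicator vector of a finite set -/
def ind (X : Finset S) : S → ℚ := fun x => if x ∈ X then 1 else 0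

/-- the indicator of `wX` is the relabelling of the indicator of `X` -/
theorem ind_smulF (w : Equiv.Perm S) (X : Finset S) : ind (smulF w X) = relabel w (ind X) := by
  funext x
  simp only [relabel_apply, ind, mem_smulF]

/-- the Kubota span: the ℚ-span of the indicators of the translates `tΦ`, `t ∈ T` -/
def kubotaSpan (T : Finset (Equiv.Perm S)) (Φ : Finset S) : Submodule ℚ (S → ℚ) :=
  Submodule.span ℚ (Set.range (fun t : T => ind (smulF t Φ)))

/-- the Kubota span is transported by `relabel w` -/
theorem kubotaSpan_transport (w : Equiv.Perm S) (T : Finset (Equiv.Perm S)) (Φ : Finset S) :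
    (kubotaSpan T Φ).map (relabel w).toLinearMap = kubotaSpan (conjF w T) (smulF w Φ) := by
  unfold kubotaSpan
  rw [Submodule.map_span]
  congr 1
  ext f
  simp only [Set.mem_image, Set.mem_range, Subtype.exists, exists_prop]
  constructor
  · rintro ⟨g, ⟨t, ht, rfl⟩, rfl⟩
    refine ⟨w * t * w⁻¹, conjF_mem ht, ?_⟩
    rw [LinearEquiv.coe_coe, ← ind_smulF, ← smulF_mul, ← smulF_mul, show w * t * w⁻¹ * w = w * t by group]
  · rintro ⟨t', ht', rfl⟩
    refine ⟨ind (smulF (w⁻¹ * t' * w) Φ), ⟨w⁻¹ * t' * w, mem_conjF.1 ht', rfl⟩, ?_⟩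
    rw [LinearEquiv.coe_coe, ← ind_smulF, ← smulF_mul, ← smulF_mul, show w * (w⁻¹ * t' * w) = t' * w by group]

/-- THE KUBOTA RANK IS TRANSPORTED (Theorem A (2) of the page) -/
theorem finrank_kubotaSpan_transport (w : Equiv.Perm S) (T : Finset (Equiv.Perm S)) (Φ : Finset S) :
    Module.finrank ℚ (kubotaSpan (conjF w T) (smulF w Φ)) = Module.finrank ℚ (kubotaSpan T Φ) := by
  rw [← kubotaSpan_transport]
  exact LinearEquiv.finrank_map_eq (relabel w) (kubotaSpan T Φ)

end decEq

end HodgeRepro0.P5S4Transport
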